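import Summits.HubbardSuperconductivity.HubbardSuperconductivity.Theorems.ThermalWedgeTwSourcedCondensationEngineReduction

/-!
# Route `ThermalWedge`, crux `TwSourcedCondensation` (item `stmt-HubbardSuperconductivity-1697`):
# ENGINE skeleton of line `entropy-staircase-linear-regime` (seat c1; re-registered verbatim by seat c4) — the crux modulo E = (A) ∧ (B)

Companion of the registered skeleton `Lines/entropy_staircase_linear_regime.lean` (seat -1, v4: shallow ∨
deep). Here the two interacting inputs are stated in ENGINE NORMAL FORM and composed by the landed
`twSourcedCondensation_of_engine` (Theorems/ThermalWedgeTwSourcedCondensationEngineReduction.lean,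
p99571; staircase with free disc constant: ThermalWedgeTwSourcedCondensationDiscStaircase.lean, p98808):

* `stub_engineDiscSlack` (A): two-sided interaction slack of the sourced gain on a disc `|h| ≤ κ/β`,
  `∃ κ ∀ η ∃ U₀ a K`, `|D_L(β,h)| ≤ (η log β + K)h²`, `D_L(β,h) = [p̃_U(h) − p̃_0(h)] − [p̃_U(0) − p̃_0(0)]`;
* `stub_engineHeatChordSlack` (B): interaction slack of the dyadic heat chord AT ZERO SOURCE,
  `∀ η ∃ U₀ a K'`, `[p̃_U(β/2,0) − p̃_U(β,0)] − [p̃_0(β/2,0) − p̃_0(β,0)] ≤ (η log β + K')/β²`, `2 ≤ β ≤ e^{a/U}`.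

The same pair closes the sister crux (`twSourcedInertness_of_engine`). Both stubs are the free-energy and
pair-susceptibility sectors of ONE Benfatto–Giuliani–Mastropietro-type one-cutoff (`U log β ≤ a`) sourced
expansion at general filling `μ ∈ (−4,0)` — not in print; `sorry` only in the two stubs.
-/

noncomputable section

namespace Summit.HubbardSuperconductivity.HubbardSuperconductivity.Theorems

open Matrix Finset Literature.MathematicalPhysics.QuantumLattice
open Summit.HubbardSuperconductivity.HubbardSuperconductivity.Theses.ThermalWedge

/-- **Stub (A): engine disc slack** (two-sided, free disc constant; constructive). -/
theorem stub_engineDiscSlack :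
    ∀ μ₁ μ₂ : ℝ, -4 < μ₁ → μ₁ ≤ μ₂ → μ₂ < 0 → ∃ κ : ℝ, 0 < κ ∧ ∀ η : ℝ, 0 < η →
      ∃ U₀ a K : ℝ, 0 < U₀ ∧ 0 < a ∧ 0 < K ∧ ∀ U : ℝ, 0 < U → U ≤ U₀ →
      ∀ β : ℝ, 1 ≤ β → β ≤ Real.exp (a / U) → ∀ μ ∈ Set.Icc μ₁ μ₂, ∃ L₀ : ℕ,
      ∀ (L : ℕ) [NeZero L], L₀ ≤ L → ∀ h : ℝ, |h| ≤ κ / β →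
        |(Real.log (Matrix.partitionFn β
            (Literature.MathematicalPhysics.QuantumLattice.dWaveSourceTorus L U μ h)).re /
            (β * (L : ℝ) ^ 2) -
            Real.log (Matrix.partitionFn β
            (Literature.MathematicalPhysics.QuantumLattice.dWaveSourceTorus L 0 μ h)).re /
            (β * (L : ℝ) ^ 2)) -
          (Real.log (Matrix.partitionFn β
            (Literature.MathematicalPhysics.QuantumLattice.dWaveSourceTorus L U μ 0)).re /
            (β * (L : ℝ) ^ 2) -
            Real.log (Matrix.partitionFn β
            (Literature.MathematicalPhysics.QuantumLattice.dWaveSourceTorus L 0 μ 0)).re /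
            (β * (L : ℝ) ^ 2))| ≤
        (η * Real.log β + K) * h ^ 2 := by
  sorry

/-- **Stub (B): engine heat-chord slack at zero source** (constructive). -/
theorem stub_engineHeatChordSlack :
    ∀ μ₁ μ₂ : ℝ, -4 < μ₁ → μ₁ ≤ μ₂ → μ₂ < 0 → ∀ η : ℝ, 0 < η →
      ∃ U₀ a K' : ℝ, 0 < U₀ ∧ 0 < a ∧ 0 < K' ∧ ∀ U : ℝ, 0 < U → U ≤ U₀ →
      ∀ β : ℝ, 2 ≤ β → β ≤ Real.exp (a / U) → ∀ μ ∈ Set.Icc μ₁ μ₂, ∃ L₀ : ℕ,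
      ∀ (L : ℕ) [NeZero L], L₀ ≤ L →
        (Real.log (Matrix.partitionFn (β / 2)
            (Literature.MathematicalPhysics.QuantumLattice.dWaveSourceTorus L U μ 0)).re /
            (β / 2 * (L : ℝ) ^ 2) -
            Real.log (Matrix.partitionFn β
            (Literature.MathematicalPhysics.QuantumLattice.dWaveSourceTorus L U μ 0)).re /
            (β * (L : ℝ) ^ 2)) -
          (Real.log (Matrix.partitionFn (β / 2)
            (Literature.MathematicalPhysics.QuantumLattice.dWaveSourceTorus L 0 μ 0)).re /
            (β / 2 * (L : ℝ) ^ 2) -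
            Real.log (Matrix.partitionFn β
            (Literature.MathematicalPhysics.QuantumLattice.dWaveSourceTorus L 0 μ 0)).re /
            (β * (L : ℝ) ^ 2)) ≤
        (η * Real.log β + K') / β ^ 2 := by
  sorry

/-- **The crux from the two engine stubs** (composition landed as `twSourcedCondensation_of_engine`). -/
theorem TwSourcedCondensation_of : TwSourcedCondensation :=
  twSourcedCondensation_of_engine stub_engineDiscSlack stub_engineHeatChordSlack

/-- **The sister crux from the same two stubs** (`twSourcedInertness_of_engine`). -/
theorem TwSourcedInertness_of : TwSourcedInertness :=
  twSourcedInertness_of_engine stub_engineDiscSlack stub_engineHeatChordSlack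

end Summit.HubbardSuperconductivity.HubbardSuperconductivity.Theorems
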